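/-
B2b (LevelGradedCohnUmans, decidable (m,k) = (2,1) cell) — gen 17.
**The ratio group of a monomial member; the split image law.**

VALUE = THEOREM (unconditional, all odd `p`), NOT summit progress; the crux item
`SubgroupIdentityDesigns` is untouched and remains open.
Report: `run/shared/lean/b2b/levelgraded-cu/ORACLE-g17.md` §G17-5 (S-g).
-/
import Mathlib
import Summits.MatrixMultiplication.MatrixMultiplication.Theorems.SubgroupIdentityDesigns.Negative.SingerFrobenius
import Summits.MatrixMultiplication.MatrixMultiplication.Theorems.SubgroupIdentityDesigns.Negative.DicksonFamilyI

/-!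
# The ratio group of a monomial member and the split image law

Split-type counterpart of `SingerFrobenius`: a subgroup `H ≤ GL₂(𝔽_p)` conjugate into the
monomial group `N(T_s)` with `-1 ∉ H`, scalar part `S_H = scalarHom⁻¹(H)`.

* `diagRatioHom` — the RATIO HOMOMORPHISM `d ↦ d₀₀/d₁₁` on a subgroup `D` of the diagonal torus
  (`DicksonFamilyI.diagSubgroup`); its kernel is the scalar part (`card_ker_diagRatioHom`), so
  `|D| = |S_D| · w` with `w = |ratio group| ∣ p - 1` (`card_diag_eq`);
* `neg_one_mem_of_antidiag` — an antidiagonal `a ∈ H` and a diagonal `d ∈ H` of ratio `-1` give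
  `-1 = (a d)(d a)⁻¹ ∈ H`; `exists_ratio_neg_one` — a ratio group of even order contains `-1`;
* `card_law_of_conj_monomial` — SPLIT LAW: `|H| = |S_H| · w` with `w ∣ p - 1` (the conjugate
  is diagonal), or `|H| = |S_H| · 2w` with `w ∣ p - 1` and `w` ODD (an antidiagonal element is
  present: the diagonal part has index two and its ratio group must have odd order).

At `p = 31`: a split member without `-1` has projective image of order dividing `30`.
-/

set_option linter.dupNamespace false

noncomputable section

open scoped Classical
open Summit.MatrixMultiplication.MatrixMultiplication.Theorems.LieRankDesigns.Negative (GLm Mat)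
open Literature.NumberTheory.EllipticCurves.BinaryQuartic (two_ne_zero_zmod)

namespace Summit.MatrixMultiplication.MatrixMultiplication.Theorems.SubgroupIdentityDesigns.Negative

section MonomialRatio

variable {p : ℕ} [hp : Fact p.Prime]

/-! ## Split type: the ratio group of the diagonal part -/

/-- The ratio `d₀₀ / d₁₁` of a member of a subgroup of the diagonal torus, as a unit. -/
def diagRatio {D : Subgroup (GLm p 2)} (hD : D ≤ diagSubgroup p) (d : D) : (ZMod p)ˣ :=
  Units.mk0 (((d : GLm p 2) : Mat p 2) 0 0 / ((d : GLm p 2) : Mat p 2) 1 1)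
    (div_ne_zero (diag_entries_ne_zero (hD d.2)).1 (diag_entries_ne_zero (hD d.2)).2)

/-- The ratio is multiplicative. -/
theorem diagRatio_mul {D : Subgroup (GLm p 2)} (hD : D ≤ diagSubgroup p) (d e : D) :
    diagRatio hD (d * e) = diagRatio hD d * diagRatio hD e := by
  apply Units.ext
  simp only [diagRatio, Units.val_mul, Units.val_mk0, Subgroup.coe_mul]
  obtain ⟨d01, d10⟩ := mem_diagSubgroup.mp (hD d.2)
  obtain ⟨e01, e10⟩ := mem_diagSubgroup.mp (hD e.2)
  have h0 := (diag_entries_ne_zero (hD d.2)).2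
  have h1 := (diag_entries_ne_zero (hD e.2)).2
  simp only [Matrix.mul_apply, Fin.sum_univ_two, d01, d10, e01, e10, mul_zero, add_zero,
    zero_add]
  rw [div_mul_div_comm]

/-- The RATIO HOMOMORPHISM `d ↦ d₀₀/d₁₁` on a subgroup of the diagonal torus. -/
def diagRatioHom {D : Subgroup (GLm p 2)} (hD : D ≤ diagSubgroup p) : D →* (ZMod p)ˣ :=
  MonoidHom.mk' (diagRatio hD) (diagRatio_mul hD)

/-- `diagRatioHom hD d` has value `d₀₀ / d₁₁`. -/
theorem diagRatioHom_val {D : Subgroup (GLm p 2)} (hD : D ≤ diagSubgroup p) (d : D) :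
    ((diagRatioHom hD d : (ZMod p)ˣ) : ZMod p) = ((d : GLm p 2) : Mat p 2) 0 0 / ((d : GLm p 2) : Mat p 2) 1 1 :=
  rfl

/-- The kernel of the ratio homomorphism is the scalar part: `|ker| = |S_D|`. -/
theorem card_ker_diagRatioHom {D : Subgroup (GLm p 2)} (hD : D ≤ diagSubgroup p) :
    Nat.card (diagRatioHom hD).ker = Nat.card (D.comap (scalarHom p 2)) := by
  classical
  -- the map u ↦ scalarHom u from S_D to the kernel is a bijection
  let ψ : D.comap (scalarHom p 2) → (diagRatioHom hD).ker := fun u =>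
    ⟨⟨scalarHom p 2 (u : (ZMod p)ˣ), Subgroup.mem_comap.mp u.2⟩, by
      rw [MonoidHom.mem_ker]
      apply Units.ext
      rw [diagRatioHom_val, Units.val_one]
      have h := (mem_range_scalarHom_iff (scalarHom p 2 (u : (ZMod p)ˣ))).mp ⟨_, rfl⟩
      change ((scalarHom p 2 (u : (ZMod p)ˣ) : GLm p 2) : Mat p 2) 0 0 /
          ((scalarHom p 2 (u : (ZMod p)ˣ) : GLm p 2) : Mat p 2) 1 1 = 1
      rw [h.2.2]
      refine div_self ?_
      have hd := diag_entries_ne_zero (hD (Subgroup.mem_comap.mp u.2))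
      exact hd.1⟩
  refine (Nat.card_congr (Equiv.ofBijective ψ ⟨?_, ?_⟩)).symm
  · intro u v h
    have h' := congrArg (fun x : (diagRatioHom hD).ker => ((x : D) : GLm p 2)) h
    exact Subtype.ext (scalarHom_injective h')
  · rintro ⟨⟨d, hdD⟩, hd⟩
    rw [MonoidHom.mem_ker] at hd
    have hd' := congrArg (fun x : (ZMod p)ˣ => (x : ZMod p)) hd
    simp only [diagRatioHom_val, Units.val_one] at hd'
    have hne := (diag_entries_ne_zero (hD hdD)).2
    have heq : (d : Mat p 2) 1 1 = (d : Mat p 2) 0 0 := by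
      change (d : Mat p 2) 0 0 / (d : Mat p 2) 1 1 = 1 at hd'
      rw [div_eq_iff hne, one_mul] at hd'
      exact hd'.symm
    obtain ⟨d01, d10⟩ := mem_diagSubgroup.mp (hD hdD)
    obtain ⟨u, hu⟩ := (mem_range_scalarHom_iff d).mpr ⟨d01, d10, heq⟩
    refine ⟨⟨u, ?_⟩, ?_⟩
    · rw [Subgroup.mem_comap, hu]; exact hdD
    · apply Subtype.ext; apply Subtype.ext
      exact hu

/-- `|D| = |S_D| · w` with `w = |ratio group| ∣ p - 1`, for `D` inside the diagonal torus. -/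
theorem card_diag_eq {D : Subgroup (GLm p 2)} (hD : D ≤ diagSubgroup p) :
    Nat.card D = Nat.card (D.comap (scalarHom p 2)) * Nat.card (diagRatioHom hD).range ∧
      Nat.card (diagRatioHom hD).range ∣ p - 1 := by
  classical
  refine ⟨?_, ?_⟩
  · rw [Subgroup.card_eq_card_quotient_mul_card_subgroup (diagRatioHom hD).ker,
      Nat.card_congr (QuotientGroup.quotientKerEquivRange (diagRatioHom hD)).toEquiv,
      card_ker_diagRatioHom hD, mul_comm]
  · have h := Subgroup.card_subgroup_dvd_card (diagRatioHom hD).range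
    rwa [Nat.card_eq_fintype_card (α := (ZMod p)ˣ), ZMod.card_units p] at h

/-- A ratio group of even order contains `-1`: some `d ∈ D` has `d₁₁ = -d₀₀`. -/
theorem exists_ratio_neg_one {D : Subgroup (GLm p 2)} (hD : D ≤ diagSubgroup p)
    (hev : 2 ∣ Nat.card (diagRatioHom hD).range) :
    ∃ d ∈ D, (d : Mat p 2) 1 1 = -(d : Mat p 2) 0 0 := by
  classical
  obtain ⟨c, hc⟩ := exists_prime_orderOf_dvd_card' 2 hev
  have hc2 : ((c : (ZMod p)ˣ)) * (c : (ZMod p)ˣ) = 1 := by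
    have h := pow_orderOf_eq_one c
    rw [hc] at h
    have h' := congrArg (fun x : (diagRatioHom hD).range => (x : (ZMod p)ˣ)) h
    simpa [pow_two] using h'
  have hc1 : (c : (ZMod p)ˣ) ≠ 1 := by
    intro h
    have : c = 1 := Subtype.ext h
    rw [this, orderOf_one] at hc
    exact absurd hc (by norm_num)
  have hcneg : ((c : (ZMod p)ˣ) : ZMod p) = -1 := by
    have h := congrArg (fun x : (ZMod p)ˣ => (x : ZMod p)) hc2
    simp only [Units.val_mul, Units.val_one] at h
    rcases mul_self_eq_one_iff.mp h with h1 | h1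
    · exact absurd (Units.ext h1) hc1
    · exact h1
  obtain ⟨_, ⟨d, rfl⟩⟩ := c
  refine ⟨(d : GLm p 2), d.2, ?_⟩
  have hv := diagRatioHom_val hD d
  change (((diagRatioHom hD) d : (ZMod p)ˣ) : ZMod p) = -1 at hcneg
  rw [hcneg] at hv
  have hne := (diag_entries_ne_zero (hD d.2)).2
  rw [eq_div_iff hne] at hv
  linear_combination -hv

/-- Entries of `(-1) · g`. -/
theorem neg_one_mul_apply (g : GLm p 2) (i j : Fin 2) :
    ((scalarHom p 2 (-1) * g : GLm p 2) : Mat p 2) i j = -(g : Mat p 2) i j := by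
  rw [Units.val_mul, coe_scalarHom, Units.val_neg, Units.val_one, Matrix.scalar_apply,
    Matrix.diagonal_mul, neg_one_mul]

/-- **Antidiagonal × ratio `-1` gives `-1`**: if `a ∈ H` is antidiagonal and `d ∈ H` is diagonal
with `d₁₁ = -d₀₀`, then `-1 = (a d)(d a)⁻¹ ∈ H`. -/
theorem neg_one_mem_of_antidiag {H : Subgroup (GLm p 2)} {a d : GLm p 2} (ha : a ∈ H) (hd : d ∈ H)
    (ha' : (a : Mat p 2) 0 0 = 0 ∧ (a : Mat p 2) 1 1 = 0)
    (hd' : (d : Mat p 2) 0 1 = 0 ∧ (d : Mat p 2) 1 0 = 0)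
    (hneg : (d : Mat p 2) 1 1 = -(d : Mat p 2) 0 0) : scalarHom p 2 (-1) ∈ H := by
  have key : a * d = scalarHom p 2 (-1) * (d * a) := by
    obtain ⟨a00, a11⟩ := ha'
    obtain ⟨d01, d10⟩ := hd'
    apply gl2_ext <;> rw [neg_one_mul_apply] <;>
      simp only [gl2_mul_apply, a00, a11, d01, d10, hneg] <;> ring
  have h : scalarHom p 2 (-1) = (a * d) * (d * a)⁻¹ := by
    rw [key, mul_inv_cancel_right]
  rw [h]
  exact H.mul_mem (H.mul_mem ha hd) (H.inv_mem (H.mul_mem hd ha))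

/-- **Split law.**  A subgroup conjugate into the monomial group that avoids `-1` has
`|H| = |S_H| · w` with `w ∣ p - 1` (all-diagonal conjugate), or `|H| = |S_H| · 2w` with
`w ∣ p - 1` and `w` odd (an antidiagonal element present). -/
theorem card_law_of_conj_monomial {H : Subgroup (GLm p 2)} {g : GLm p 2}
    (hg : ∀ x ∈ H, IsMonomial (g * x * g⁻¹)) (hneg : scalarHom p 2 (-1) ∉ H) :
    ∃ w : ℕ, w ∣ p - 1 ∧
      (Nat.card H = Nat.card (H.comap (scalarHom p 2)) * w ∨
        (Odd w ∧ Nat.card H = Nat.card (H.comap (scalarHom p 2)) * (2 * w))) := by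
  classical
  set H' := H.map (MulAut.conj g).toMonoidHom with hH'
  have hmem : ∀ y, y ∈ H' ↔ g⁻¹ * y * g ∈ H := fun y => mem_map_conj_iff'
  have hmon : ∀ y ∈ H', IsMonomial y := by
    intro y hy
    have e : y = g * (g⁻¹ * y * g) * g⁻¹ := by group
    have h := hg _ ((hmem y).mp hy)
    rw [← e] at h
    exact h
  have hneg' : scalarHom p 2 (-1) ∉ H' := neg_one_not_mem_map_conj g hneg
  suffices h : ∃ w : ℕ, w ∣ p - 1 ∧
      (Nat.card H' = Nat.card (H'.comap (scalarHom p 2)) * w ∨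
        (Odd w ∧ Nat.card H' = Nat.card (H'.comap (scalarHom p 2)) * (2 * w))) by
    rwa [hH', card_map_conj_eq, comap_scalarHom_map_conj] at h
  -- the diagonal part D and its ratio group
  set D : Subgroup (GLm p 2) := H' ⊓ diagSubgroup p with hDdef
  have hD : D ≤ diagSubgroup p := inf_le_right
  have hDle : D ≤ H' := inf_le_left
  obtain ⟨hcardD, hwdvd⟩ := card_diag_eq hD
  set w := Nat.card (diagRatioHom hD).range with hw
  have hSD : D.comap (scalarHom p 2) = H'.comap (scalarHom p 2) := by
    ext u
    simp only [Subgroup.mem_comap, hDdef, Subgroup.mem_inf, mem_diagSubgroup]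
    have h := (mem_range_scalarHom_iff (scalarHom p 2 u)).mp ⟨u, rfl⟩
    exact ⟨fun h' => h'.1, fun h' => ⟨h', h.1, h.2.1⟩⟩
  rw [hSD] at hcardD
  refine ⟨w, hwdvd, ?_⟩
  by_cases hall : ∀ y ∈ H', y ∈ diagSubgroup p
  · -- all diagonal: H' = D
    left
    have hDeq : D = H' := le_antisymm hDle (fun y hy => Subgroup.mem_inf.mpr ⟨hy, hall y hy⟩)
    rw [← hDeq, hcardD, hSD]
  · right
    simp only [not_forall] at hall
    obtain ⟨a, haH, had⟩ := hall
    have ha' : (a : Mat p 2) 0 0 = 0 ∧ (a : Mat p 2) 1 1 = 0 := by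
      rcases hmon a haH with h | h
      · exact absurd (mem_diagSubgroup.mpr h) had
      · exact h
    -- w is odd, else -1 ∈ H'
    have hwodd : Odd w := by
      by_contra hev
      rw [Nat.not_odd_iff_even, even_iff_two_dvd] at hev
      obtain ⟨d, hdD, hdneg⟩ := exists_ratio_neg_one hD hev
      exact hneg' (neg_one_mem_of_antidiag haH (hDle hdD) ha' (mem_diagSubgroup.mp (hD hdD)) hdneg)
    refine ⟨hwodd, ?_⟩
    -- |H'| = 2 |D|
    let D' : Subgroup H' := D.subgroupOf H'
    have hcardD' : Nat.card D' = Nat.card D :=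
      Nat.card_congr (Subgroup.subgroupOfEquivOfLe hDle).toEquiv
    have hmul : Nat.card D' * D'.index = Nat.card H' := Subgroup.card_mul_index D'
    have hainv : ((a⁻¹ : GLm p 2) : Mat p 2) 0 0 = 0 ∧ ((a⁻¹ : GLm p 2) : Mat p 2) 1 1 = 0 := by
      rcases hmon _ (H'.inv_mem haH) with h | h
      · exfalso
        apply had
        have := (diagSubgroup p).inv_mem (show a⁻¹ ∈ diagSubgroup p from h)
        rw [inv_inv] at this
        exact this
      · exact h
    have hidx : D'.index ≤ 2 := by
      rw [Subgroup.index_eq_card]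
      let f : Bool → H' ⧸ D' := fun b =>
        if b then ((1 : H') : H' ⧸ D') else ((⟨a, haH⟩ : H') : H' ⧸ D')
      have hf : Function.Surjective f := by
        intro q
        obtain ⟨x, rfl⟩ := QuotientGroup.mk_surjective q
        by_cases hx : (x : GLm p 2) ∈ diagSubgroup p
        · refine ⟨true, ?_⟩
          simp only [f, if_true]
          rw [QuotientGroup.eq, inv_one, one_mul, Subgroup.mem_subgroupOf]
          exact Subgroup.mem_inf.mpr ⟨x.2, hx⟩
        · refine ⟨false, ?_⟩
          simp only [f, Bool.false_eq_true, if_false]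
          rw [QuotientGroup.eq, Subgroup.mem_subgroupOf]
          have hxm : ((x : GLm p 2) : Mat p 2) 0 0 = 0 ∧ ((x : GLm p 2) : Mat p 2) 1 1 = 0 := by
            rcases hmon _ x.2 with h | h
            · exact absurd (mem_diagSubgroup.mpr h) hx
            · exact h
          change a⁻¹ * (x : GLm p 2) ∈ D
          refine Subgroup.mem_inf.mpr ⟨H'.mul_mem (H'.inv_mem haH) x.2, mem_diagSubgroup.mpr ?_⟩
          obtain ⟨b00, b11⟩ := hainv
          obtain ⟨x00, x11⟩ := hxm
          constructor <;> simp only [gl2_mul_apply, b00, b11, x00, x11] <;> ring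
      have := Nat.card_le_card_of_surjective f hf
      simpa using this
    have hle : Nat.card H' ≤ 2 * Nat.card D := by
      calc Nat.card H' = Nat.card D' * D'.index := hmul.symm
        _ ≤ Nat.card D' * 2 := Nat.mul_le_mul_left _ hidx
        _ = 2 * Nat.card D := by rw [hcardD', mul_comm]
    have hDdvd : Nat.card D ∣ Nat.card H' := Subgroup.card_dvd_of_le hDle
    have hne : Nat.card D ≠ Nat.card H' := by
      intro h
      have hDeq : D = H' := Subgroup.eq_of_le_of_card_ge hDle h.ge
      exact had (hD (hDeq ▸ haH : a ∈ D))
    have hge : 2 * Nat.card D ≤ Nat.card H' := two_mul_le_of_dvd_of_ne hDdvd hne Nat.card_pos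
    have heq : Nat.card H' = 2 * Nat.card D := le_antisymm hle hge
    rw [heq, hcardD]
    ring

end MonomialRatio

end Summit.MatrixMultiplication.MatrixMultiplication.Theorems.SubgroupIdentityDesigns.Negative

end
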